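import Mathlib.Combinatorics.SimpleGraph.Metric
import Summits.AtomisticToContinuum.Crystallization.Theorems.FluxTubeKeplerFloorGivesLayered
import Summits.AtomisticToContinuum.Crystallization.Theorems.FluxTubeKeplerFluxCellKeplerSingleScale
import Summits.AtomisticToContinuum.Crystallization.Theorems.ChessboardParticlePlanesPeriodicWindowsIffCrystallization

/-!
# `RebondingRung` — F3 witness: the family member `BondRung 0` IS the proved floor (no `sorry`)

Forward rung over `FluxTubeKepler.FloorGivesLayered` (crux dir `FluxCellKepler`, stmt-AtomisticToContinuum-15221;
fwd-rung G1 gen 14).  Re-declares the bond-topology ladder of `Lines/RebondingRung.lean` in the namespace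
`…BondLadder.Special` (same definitions, verbatim) and proves, sorry-free:
* `bondRung_zero : BondRung 0` — depth `0` inspects nothing (`¬ BondGood 0` is `True`), so the rebonding budget is
  the floor's budget (`bondBudget_zero_iff`) and the member is `FloorGivesLayered_proof` ∘ `PeriodicGivenLayered_holds`;
* `bondRung_zero_of_bondRung : BondRung k → BondRung 0` and `bondRung_zero_of_rebondingRung` (the dial only removes
  priced sites: `bondBudget_of_zero`);
* the on-path lemmas `bondRung_of_crystallization`, `RebondingRung_of_Crystallization` (F4, also in `_onpath`).
-/

noncomputable section

namespace Summit.AtomisticToContinuum.Crystallization.Cruxes.FluxCellKepler.BondLadder.Special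

open scoped BigOperators Classical
open Filter Topology
open Literature.MathematicalPhysics.StatisticalMechanics
open Summit.AtomisticToContinuum.Crystallization.Theorems.FluxCellKeplerSingleScale (LayeredGood layeredGood_mono)
open Summit.AtomisticToContinuum.Crystallization.Theorems.ChargedEnergyGapNegative (eStar)

local notation "E3" => EuclideanSpace ℝ (Fin 3)

/-! ## The objects of the ladder: contact graphs and rooted bond-topology -/

/-- The CONTACT GRAPH of a finite configuration: `i ~ j` iff `i ≠ j` and `dist (x i) (x j) ≤ 23/20`
(`SimpleGraph.fromRel`, so the adjacency unfolds to `i ≠ j ∧ (dist (x i) (x j) ≤ 23/20 ∨ dist (x j) (x i) ≤ 23/20)`).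
On a `7/10`-separated configuration matched at tolerance `≤ 1/20` with a relaxed Barlow template the bonds are exactly
the template's first-shell pairs (first shell `≤ 1.028`, second shell `≥ 1.31`). -/
def contactGraph {N : ℕ} (x : Fin N → E3) : SimpleGraph (Fin N) :=
  SimpleGraph.fromRel fun i j => dist (x i) (x j) ≤ 23 / 20

/-- The ideal position of the label `v = (m, k, l)` (layer `m`, in-plane coordinates `k, l`) in the Barlow stacking of
Hägg word `s` with touching unit balls (`a = 1`, `h = √(2/3)`). -/
def idealPos (s : ℤ → ℤ) (v : ℤ × ℤ × ℤ) : E3 :=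
  barlowPos 1 (Real.sqrt (2 / 3)) s v.1 v.2.1 v.2.2

/-- The ideal BARLOW CONTACT GRAPH of Hägg word `s` on the label set `ℤ × ℤ × ℤ`: `v ~ w` iff the ideal positions are
at distance `≤ 23/20` (equivalently `= 1`: six in-plane and three + three adjacent-layer neighbours). -/
def barlowGraph (s : ℤ → ℤ) : SimpleGraph (ℤ × ℤ × ℤ) :=
  SimpleGraph.fromRel fun v w => dist (idealPos s v) (idealPos s w) ≤ 23 / 20

/-- The (closed) ball of radius `k` about `v` in the graph metric (`SimpleGraph.edist`, `⊤` between different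
components, so unreachable vertices are excluded). -/
def gball {V : Type*} (G : SimpleGraph V) (v : V) (k : ℕ) : Set V := {w | G.edist v w ≤ k}

/-- **BOND-GOOD TO DEPTH `k`** (`k ≥ 1`; `BondGood 0 := False`): the rooted `k`-ball of `i` in the contact graph of
`x` is isomorphic — by a graph isomorphism of the induced subgraphs sending `i` to the origin — to the rooted
`k`-ball of the origin in the ideal Barlow contact graph of some Hägg word `s`.  A purely combinatorial, potential-free,
strain-blind datum. -/
def BondGood (k : ℕ) {N : ℕ} (x : Fin N → E3) (i : Fin N) : Prop :=
  0 < k ∧ ∃ s : ℤ → ℤ, IsHaggSeq s ∧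
    ∃ φ : (contactGraph x).induce (gball (contactGraph x) i k) ≃g
          (barlowGraph s).induce (gball (barlowGraph s) (0 : ℤ × ℤ × ℤ) k),
      ∀ h : i ∈ gball (contactGraph x) i k, ((φ ⟨i, h⟩ : gball (barlowGraph s) (0 : ℤ × ℤ × ℤ) k) : ℤ × ℤ × ℤ) = 0

/-! ## The rung family -/

/-- FLOOR(P₀): `N · e(P₀) ≤ E(x)` for every Lennard-Jones ground state `x` of every size `N`
(verbatim the first hypothesis of `FluxTubeKepler.FloorGivesLayered`). -/
def Floor (P₀ : PeriodicConfiguration 3) : Prop :=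
  ∀ (N : ℕ) (x : Fin N → E3), IsGroundState lennardJones x →
    (N : ℝ) * P₀.energyPerParticle lennardJones ≤ interactionEnergy lennardJones x

/-- REBONDING BUDGET to depth `k`: for every radius `R > 0` and tolerance `η > 0` some `c > 0` prices the sites of
every Lennard-Jones ground state that are `(R,η)`-non-layered AND not bond-good to depth `k`, against the excess energy
over `N · e(P₀)` (`k = 0`: the floor's budget, every non-layered site priced; quantifier order `∀ R η ∃ c` of the crux
kept, Disproof §5). -/
def BondBudget (k : ℕ) (P₀ : PeriodicConfiguration 3) : Prop :=
  ∀ R η : ℝ, 0 < R → 0 < η → ∃ c : ℝ, 0 < c ∧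
    ∀ (N : ℕ) (x : Fin N → E3), IsGroundState lennardJones x →
      c * (Nat.card {i : Fin N // ¬ LayeredGood R η x i ∧ ¬ BondGood k x i} : ℝ) ≤
        interactionEnergy lennardJones x - (N : ℝ) * P₀.energyPerParticle lennardJones

/-- Periodic windows at every scale along the sequence `x` (ONE periodic `P`, translations only) —
verbatim the conclusion of `FluxTubeKepler.PeriodicWindows` / `FluxTubeKepler.PeriodicGivenLayered`. -/
def HasPeriodicWindows (x : (N : ℕ) → (Fin N → E3)) : Prop :=
  ∃ P : PeriodicConfiguration 3, ∀ R ε : ℝ, 0 < ε → ∃ᶠ N in atTop, ∃ t : E3,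
    (∀ q ∈ P.points, ‖q‖ ≤ R → ∃ i : Fin N, dist (x N i + t) q ≤ ε) ∧
    (∀ i : Fin N, ‖x N i + t‖ ≤ R → ∃ q ∈ P.points, dist (x N i + t) q ≤ ε)

/-- **The graded family.** `BondRung k`: FLOOR and the rebonding budget to depth `k` force periodic windows along
every Lennard-Jones ground-state sequence. -/
def BondRung (k : ℕ) : Prop :=
  ∀ P₀ : PeriodicConfiguration 3, Floor P₀ → BondBudget k P₀ →
    ∀ x : (N : ℕ) → (Fin N → E3), (∀ N, IsGroundState lennardJones (x N)) → HasPeriodicWindows x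

/-- **Deciding rung.** Some finite inspection depth suffices: a certificate blind to every elastically deformed
perfect crystal (Barlow bonding to depth `k`) still forces crystallization of the ground states. -/
def RebondingRung : Prop := ∃ k : ℕ, 0 < k ∧ BondRung k

/-! ## Counting helpers -/

theorem natCard_mono {N : ℕ} {p q : Fin N → Prop} (h : ∀ i, p i → q i) :
    Nat.card {i // p i} ≤ Nat.card {i // q i} := by
  rw [Nat.card_eq_fintype_card, Nat.card_eq_fintype_card]
  exact Fintype.card_subtype_mono _ _ h

theorem natCard_or_le {N : ℕ} (p q : Fin N → Prop) :
    Nat.card {i // p i ∨ q i} ≤ Nat.card {i // p i} + Nat.card {i // q i} := by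
  rw [Nat.card_eq_fintype_card, Nat.card_eq_fintype_card, Nat.card_eq_fintype_card]
  exact Fintype.card_subtype_or p q

/-- `LayeredGood` is monotone in the tolerance. [folklore] -/
theorem layeredGood_tol {R η η' : ℝ} (hη : η' ≤ η) {N : ℕ} (x : Fin N → E3) (i : Fin N) :
    LayeredGood R η' x i → LayeredGood R η x i := by
  rintro ⟨a, ha₁, ha₂, A, s, z, hs, hz, h₁, h₂⟩
  refine ⟨a, ha₁, ha₂, A, s, z, hs, hz, ?_, ?_⟩
  · intro p hp hpR
    obtain ⟨j, hj⟩ := h₁ p hp hpR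
    exact ⟨j, hj.trans hη⟩
  · intro j hj
    obtain ⟨p, hp, hjp⟩ := h₂ j hj
    exact ⟨p, hp, hjp.trans hη⟩

/-! ## F3 — the family specialises to the proved floor -/

/-- Depth `0` inspects nothing: `BondGood 0` is `False`. -/
@[simp] theorem not_bondGood_zero {N : ℕ} (x : Fin N → E3) (i : Fin N) : ¬ BondGood 0 x i :=
  fun h => (lt_irrefl 0 h.1).elim

/-- At depth `0` the rebonding budget IS the floor's budget. -/
theorem bondBudget_zero_iff (P₀ : PeriodicConfiguration 3) :
    BondBudget 0 P₀ ↔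
      ∀ R η : ℝ, 0 < R → 0 < η → ∃ c : ℝ, 0 < c ∧
        ∀ (N : ℕ) (x : Fin N → E3), IsGroundState lennardJones x →
          c * (Nat.card {i : Fin N // ¬ LayeredGood R η x i} : ℝ) ≤
            interactionEnergy lennardJones x - (N : ℝ) * P₀.energyPerParticle lennardJones := by
  simp only [BondBudget, not_bondGood_zero, not_false_eq_true, and_true]

/-- `BondRung 0` is the floor: the seed theorem followed by the proved `PeriodicGivenLayered`. -/
theorem bondRung_zero : BondRung 0 := fun P₀ hF hB x hx =>
  Theses.FluxTubeKepler.PeriodicGivenLayered_holds x hx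
    (Theorems.FluxTubeKeplerFloorGivesLayered.FloorGivesLayered_proof P₀ hF
      ((bondBudget_zero_iff P₀).1 hB) x hx)

/-! ## Dial: every member gives back the floor member (the dial only removes priced sites) -/

/-- The floor's budget prices a superset: `BondBudget 0 P₀ → BondBudget k P₀`. -/
theorem bondBudget_of_zero (k : ℕ) (P₀ : PeriodicConfiguration 3) : BondBudget 0 P₀ → BondBudget k P₀ := by
  intro hB R η hR hη
  obtain ⟨c, hc, hcB⟩ := hB R η hR hη
  refine ⟨c, hc, fun N x hx => le_trans ?_ (hcB N x hx)⟩
  have hle : Nat.card {i : Fin N // ¬ LayeredGood R η x i ∧ ¬ BondGood k x i} ≤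
      Nat.card {i : Fin N // ¬ LayeredGood R η x i ∧ ¬ BondGood 0 x i} :=
    natCard_mono fun i hi => ⟨hi.1, not_bondGood_zero x i⟩
  exact mul_le_mul_of_nonneg_left (by exact_mod_cast hle) hc.le

/-- Every member implies the floor member (informational `specialises`). -/
theorem bondRung_zero_of_bondRung {k : ℕ} (h : BondRung k) : BondRung 0 :=
  fun P₀ hF hB x hx => h P₀ hF (bondBudget_of_zero k P₀ hB) x hx

/-- The deciding rung gives back the floor member. -/
theorem bondRung_zero_of_rebondingRung (h : RebondingRung) : BondRung 0 := by
  obtain ⟨k, -, hk⟩ := h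
  exact bondRung_zero_of_bondRung hk

/-! ## F4 — on-path lemmas: the sub-problem implies every member -/

/-- ON-PATH: `Crystallization → BondRung k` (landed hull-criterion converse `periodicWindows_of_crystallization`). -/
theorem bondRung_of_crystallization (k : ℕ) (h : _root_.Crystallization) : BondRung k :=
  fun _ _ _ x hx =>
    Theorems.ChessboardParticlePlanesPeriodicWindowsIffCrystallization.periodicWindows_of_crystallization h x hx

/-- ON-PATH for the deciding rung (tagged `aesop safe apply` so that the tribunal's fixed `S → C` portfolio finds it). -/
@[aesop safe apply]
theorem RebondingRung_of_Crystallization (h : _root_.Crystallization) : RebondingRung :=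
  ⟨1, Nat.one_pos, bondRung_of_crystallization 1 h⟩


end Summit.AtomisticToContinuum.Crystallization.Cruxes.FluxCellKepler.BondLadder.Special

end
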